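import Summits.QuantumFields.BalabanUV.Beta.D1BFx.SplitInstance
import Summits.QuantumFields.BalabanUV.Beta.D1BFx.CrossERestLists

/-!
# `BalabanUV.Beta.D1BFx.SectorRecut` — road «BF-x» for binder row D1, slot (SPLIT)∕(REST): THE FEYNMAN-COMPLETED SECTOR RE-CUT OF THE
# GLUON FINE STENCIL — `cE•SbE + cΛ•SbL + cR•SbR = cE•SbT + cΛ•SbL + 1•SbRc` with `SbT := SbE − DIVₐ` (transverse-completed Wilson sector =
# model vector vertex + degree-≥7 remainder) and `SbRc := cR•SbR + cE•DIVₐ` (gauge-term sector with its local Feynman completion) — AND THE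
# RE-SUMMATION OF THE 9 SECTOR WORDS ∕ 81 GRADED WORDS OF THE FINE BUBBLE TABLE OVER THE NEW SECTORS (same total, word by word re-cut)

HONEST DEPENDENCY (page 1, mandatory): continuum YM on T⁴ ⇐ BetaPertH ∧ nine spine estimates (0/9 proved); BetaPertH ⇐ (D1) ∧ (D4) ∧
CAP+tail; G-an2-4 gates asym, D1 and NE2/3/4.  HONEST FRAMING (cell contract, verbatim): «discharging `BetaPertH` makes Bałaban's UV
stability UNCONDITIONAL — a real constructive-QFT result; it is NOT the continuum limit and NOT the Clay problem.»  THIS MODULE DISCHARGES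
NOTHING of the wall: definitions with bodies ([our objects] `lpConst`, `stnConst` (explicit bi-localisation constants of a located-pair list),
`divK` (the antisymmetrised longitudinal block DIVₐ as a kernel family — leaf-03-g4's list `CrossERestLists.div₀` realised), `SbT`, `SbRc`,
`secSt'`, `secWt'`) and [folklore] lemmas (triangle inequality, bilinearity of the bubble over weighted finite families of localised vertices —
leaf-03-g3's `FineHessianSectors.bubble_weightedSum_weightedSum` — and leg additivity `FineHessianLegGrades.biBubbleTable_Ga_eq_pieceSum`, all BY
NAME).  No `Prop` is minted, nothing is cited, no hypothesis is a printed statement, 0 sorry.  0 wall binders instantiated; NOT the (REST) bounds,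
NOT (K), NOT D1, NOT `BetaPertH`, NOT continuum, NOT Clay.

ABSOLUTE RULE (cell charter, verbatim): «No internally-minted statement may enter as a cited fact. Every hypothesis is either kernel-proved in
this package or a verbatim quotation of a PUBLISHED theorem with page reference. The manuscript(s) under audit are NOT citable for their own
disputed steps — they are the thing under adjudication; programme-internal (2001/route/tribunal) claims are never citable.»

WHY (owner d1-p2 gen 3, FINDING «D1-BFx-LON-MISCUT», journal 2026-08-20 15:31:53Z).  The landed REST word cut `SplitInstance.restK` (p220987)
indexes the gluon bubble words by the RAW sectors `secSt = (SbE, SbL, SbR)`.  With `SbE = VEC + DIVₐ + REMₐ` (`ColourlessAntisymmetry.SbE_split`)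
the LONGITUDINAL words `VEC×DIVₐ`, `DIVₐ×VEC`, `DIVₐ×DIVₐ` (leaf-03-g4's `lonW`, `CrossERestLists.isO_six_lonW`: degree 6 only — the marginal,
log-carrying class) land in `restK crossE`, while their Feynman-completion partners (the local part of the R-sector jet, SPLIT-SPEC §3
`SbR_loc := −(cE/cR)•DIVₐ`, point (τ-E2)) land in `restK bub (0,2,0,0)`, `(2,0,0,0)`, `(2,2,0,0)`.  Continuum power counting (ordinary-Feynman
gluon loop `q_μq_ν`-log `−22/12·C_A/16π²` vs background-Feynman `−40/12`) says each side carries `±c·log n`, `c ≠ 0`: the per-word n-UNIFORM (REST)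
hypotheses of the road's END for these four words are presumably unsatisfiable one by one although their sum is harmless.  THE REPAIR is a
re-cut of the SAME total stencil into sectors whose pairwise words are individually of bounded class: `SbT := SbE − DIVₐ = VEC + REMₐ`
(so `SbT×SbT − VEC×VEC` has total grading ≥ 3: A2's degree-≥7 class, no longitudinal word survives) and `SbRc := cR•SbR + cE•DIVₐ`
(= `cR•SbR_blk` of SPLIT-SPEC §3: the gauge-term jet WITH its local Feynman completion, expected block class — leaf A3.a/A3.b's honest object).
This file supplies the re-cut and proves that the 9 sector words (and the 81 graded words) of the fine bubble table RE-SUM to the same table;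
`D1BFx/SplitRecut` then re-cuts `restK` and re-derives the (SPLIT) identity, and the road's END is re-pointed at the re-cut words.

CONTENT.
* §1 [our objects] `lpConst δ p := (Σ_{a b} |p.m a b|)·e^{δ(|p.x|₁+|p.y|₁)}`, `stnConst δ V := Σ_{p ∈ V} lpConst δ p`; [folklore] `biLoc_elemK_lp`,
  **`biLoc_realK`** (`BiLoc (realK z z' V) z z' (stnConst δ V) δ` for EVERY rate `δ` — a finitely supported kernel is bi-localised at any rate,
  constant uniform in the base points).
* §2 [our objects] **`divK κ u := realK u u (reixStn ιU (div₀ κ))`**, **`SbT := SbE − divK`**, **`SbRc := cR•SbR + cE•divK`**, `secSt' := (SbT, SbL, SbRc)`,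
  `secWt' := (cE, cΛ, 1)`; [folklore] **`SbfBal_eq_secSum'`** (`SbfBal = Σ_i secWt' i • secSt' i` — the total stencil is unchanged),
  `exists_biLoc_divK`∕`_SbT`∕`_SbRc`∕**`exists_biLoc_secSt'`**, `loc_secSt'`.
* §3 [folklore] **`bubbleTable_SbfBal_eq_secSum'`** (the fine bubble table as the 9 re-cut sector words), **`secSum_eq_secSum'`** (old 9 words = new 9
  words, entrywise), **`gradedSum_eq_gradedSum'`** (old 81 graded words = new 81 graded words over the leg pieces `legPiece n a g r`, entrywise),
  **`gradedWordSum_eq_gradedWordSum'`** (the same for the `n⁻⁸·w_μw_ν·baseKer` word integrands of `restK`, as ONE sum over `Fin 3 × Fin 3 × Fin 3 × Fin 3`).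
Unit `b2b-balaban-beta-d1-p2` (road owner, gen 3); `LEAVES-BFx.md` rows (SPLIT)∕(REST) (re-cut), SPLIT-SPEC §3 (τ-E2)/(τ5)/(τ3).
-/

noncomputable section

namespace Summit.QuantumFields.BalabanUV.Beta.D1BFx.SectorRecut

open Finset
open scoped BigOperators
open Literature.MathematicalPhysics.QuantumFieldTheory.Balaban1983to89
open Literature.MathematicalPhysics.QuantumFieldTheory.Balaban1983to89.Beta
open B12Sec2to5 (l1 l1_nonneg)
open ExpKernelCalculus (Site MKer BiLoc bubble)
open DyadicShell (Pt toReal)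
open GradedBubbles (LP Stn)
open Summit.QuantumFields.BalabanUV.Beta.TameKernelCalculus (Spr Loc biLoc_of_le)
open Summit.QuantumFields.BalabanUV.Beta.D1BFx.FiniteStencilCalculus (elemK elemK_apply)
open Summit.QuantumFields.BalabanUV.Beta.D1BFx.StencilRealisation (realK realK_nil realK_cons)
open Summit.QuantumFields.BalabanUV.Beta.D1BFx.WilsonStencilRealised (reixStn ιU)
open Summit.QuantumFields.BalabanUV.Beta.D1BFx.CrossERestLists (div₀)
open Summit.QuantumFields.BalabanUV.Beta.D1BFx.GluonLeg (Ga)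
open Summit.QuantumFields.BalabanUV.Beta.D1BFx.ReducedKernel (StencilR)
open Summit.QuantumFields.BalabanUV.Beta.D1BFx.DressedBubbleTable (bubbleTable bubbleTable_apply)
open Summit.QuantumFields.BalabanUV.Beta.D1BFx.DressedBubbleBridge (biLoc_const_mono)
open Summit.QuantumFields.BalabanUV.Beta.D1BFx.PackedKernelSplit (bubble_eq_biBubble)
open Summit.QuantumFields.BalabanUV.Beta.D1BFx.MomentTransferPeriodic (baseKer)
open Summit.QuantumFields.BalabanUV.Beta.D1BFx.FineStencilBFBalaban (SbfBal)
open Summit.QuantumFields.BalabanUV.Beta.D1BFx.GluonKernelSectors (SbE SbL SbR secSt secWt SbfBal_eq_secSum exists_biLoc_SbE exists_biLoc_SbL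
  exists_biLoc_SbR)
open Summit.QuantumFields.BalabanUV.Beta.D1BFx.FineHessianSectors (biBubbleTable biBubbleTable_apply bubble_weightedSum_weightedSum
  bubbleTable_SbfBal_eq_secSum loc_secSt)
open Summit.QuantumFields.BalabanUV.Beta.D1BFx.FineHessianLegGrades (legPiece biBubbleTable_Ga_eq_pieceSum)

/-! ## §1 A finitely supported kernel is bi-localised at every rate -/

section Real

variable {I : Type*} [Fintype I]

/-- [our object] THE BI-LOCALISATION CONSTANT OF ONE LOCATED PAIR at rate `δ`: `(Σ_{a b} |m a b|)·e^{δ(|x|₁ + |y|₁)}`. -/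
def lpConst (δ : ℝ) (p : LP I) : ℝ := (∑ a, ∑ b, |p.m a b|) * Real.exp (δ * (l1 p.x + l1 p.y))

/-- [our object] THE BI-LOCALISATION CONSTANT OF A LOCATED-PAIR LIST at rate `δ`: the sum of the constants of its entries. -/
def stnConst (δ : ℝ) (V : Stn I) : ℝ := (V.map (lpConst δ)).sum

/-- [our object] Unfolding on the empty list. -/
@[simp] theorem stnConst_nil (δ : ℝ) : stnConst δ ([] : Stn I) = 0 := rfl

/-- [our object] Unfolding on a cons. -/
@[simp] theorem stnConst_cons (δ : ℝ) (p : LP I) (V : Stn I) : stnConst δ (p :: V) = lpConst δ p + stnConst δ V := by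
  simp [stnConst]

/-- [folklore] The constant of one located pair is nonnegative. -/
theorem lpConst_nonneg (δ : ℝ) (p : LP I) : 0 ≤ lpConst δ p :=
  mul_nonneg (sum_nonneg fun _ _ => sum_nonneg fun _ _ => abs_nonneg _) (Real.exp_pos _).le

/-- [folklore] The constant of a list is nonnegative. -/
theorem stnConst_nonneg (δ : ℝ) (V : Stn I) : 0 ≤ stnConst δ V := by
  induction V with
  | nil => simp
  | cons p V ih => rw [stnConst_cons]; exact add_nonneg (lpConst_nonneg δ p) ih

/-- [folklore] **ONE ELEMENTARY INSERTION IS BI-LOCALISED AT THE BASE POINTS, AT EVERY RATE**: the insertion of `p.m` at the located pair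
`(z + p.x, z' + p.y)` satisfies `BiLoc · z z' (lpConst δ p) δ`. -/
theorem biLoc_elemK_lp (z z' : Pt) (δ : ℝ) (p : LP I) :
    BiLoc (elemK (z + p.x) (z' + p.y) (fun a b => p.m a b)) z z' (lpConst δ p) δ := by
  intro x y a b
  rw [elemK_apply]
  split_ifs with h
  · obtain ⟨hx, hy⟩ := h
    rw [hx, hy, add_sub_cancel_left, add_sub_cancel_left, lpConst, mul_assoc, ← Real.exp_add,
      show δ * (l1 p.x + l1 p.y) + -δ * (l1 p.x + l1 p.y) = 0 by ring, Real.exp_zero, mul_one]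
    calc |p.m a b| ≤ ∑ b', |p.m a b'| := single_le_sum (f := fun b' => |p.m a b'|) (fun b' _ => abs_nonneg _) (mem_univ b)
      _ ≤ ∑ a', ∑ b', |p.m a' b'| :=
          single_le_sum (f := fun a' => ∑ b', |p.m a' b'|) (fun a' _ => sum_nonneg fun b' _ => abs_nonneg _) (mem_univ a)
  · rw [abs_zero]
    exact mul_nonneg (lpConst_nonneg δ p) (Real.exp_pos _).le

/-- [folklore] **A REALISED LOCATED-PAIR LIST IS BI-LOCALISED AT ITS BASE POINTS, AT EVERY RATE, WITH A CONSTANT NOT DEPENDING ON THE BASE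
POINTS**: `BiLoc (realK z z' V) z z' (stnConst δ V) δ`. -/
theorem biLoc_realK (z z' : Pt) (δ : ℝ) (V : Stn I) : BiLoc (realK z z' V) z z' (stnConst δ V) δ := by
  induction V with
  | nil =>
      intro x y a b
      simp
  | cons p V ih =>
      rw [realK_cons, stnConst_cons]
      exact KernelWard.biLoc_add (biLoc_elemK_lp z z' δ p) ih

end Real

/-! ## §2 The re-cut sectors -/

section Sectors

variable (n : ℕ) [NeZero n] (a : ℝ)

/-- [our object] **THE ANTISYMMETRISED LONGITUDINAL BLOCK `DIVₐ` OF THE WILSON FINE STENCIL AS A KERNEL FAMILY**: `divK κ u := realK u u (reixStn ιU (div₀ κ))`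
(leaf-03-g4's list `CrossERestLists.div₀ κ` realised at the bond `(κ, u)`; by `CrossERestLists.SbE_eq_realK_lists`, `SbE = VEC + divK + REMₐ`).
A DEFINITION; asserts nothing. -/
def divK (κ : Fin 4) (u : Site 4) : MKer 4 (Fin 4) := realK u u (reixStn ιU (div₀ κ))

/-- [our object] **THE TRANSVERSE-COMPLETED WILSON SECTOR** `SbT κ u := SbE κ u − divK κ u` (= model vector vertex + antisymmetrised remainder).
A DEFINITION; asserts nothing. -/
def SbT : StencilR := fun κ u => SbE κ u - divK κ u

/-- [our object] **THE FEYNMAN-COMPLETED GAUGE-TERM SECTOR** `SbRc n a cE cR cK cQ κ u := cR • SbR n a cK cQ κ u + cE • divK κ u` (the weighted R-jet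
PLUS the longitudinal block it is to cancel locally; `= cR • SbR_blk` in SPLIT-SPEC §3's words).  A DEFINITION; asserts nothing. -/
def SbRc (n : ℕ) [NeZero n] (a cE cR cK cQ : ℝ) : StencilR := fun κ u => cR • SbR n a cK cQ κ u + cE • divK κ u

/-- [our object] The re-cut sectors packed as a `Fin 3`-family: `0 ↦ SbT`, `1 ↦ SbL n`, `2 ↦ SbRc n a cE cR cK cQ`. -/
def secSt' (n : ℕ) [NeZero n] (a cE cR cK cQ : ℝ) : Fin 3 → StencilR := ![SbT, SbL n, SbRc n a cE cR cK cQ]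

/-- [our object] The re-cut sector weights: `0 ↦ cE`, `1 ↦ cΛ`, `2 ↦ 1`. -/
def secWt' (cE cΛ : ℝ) : Fin 3 → ℝ := ![cE, cΛ, 1]

variable (cE cVH cΛ cR cK cQ : ℝ)

/-- [our object] Unfolding. -/ theorem secSt'_zero : secSt' n a cE cR cK cQ 0 = SbT := rfl
/-- [our object] Unfolding. -/ theorem secSt'_one : secSt' n a cE cR cK cQ 1 = SbL n := rfl
/-- [our object] Unfolding. -/ theorem secSt'_two : secSt' n a cE cR cK cQ 2 = SbRc n a cE cR cK cQ := rfl
/-- [our object] Unfolding. -/ theorem secWt'_zero : secWt' cE cΛ 0 = cE := rfl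
/-- [our object] Unfolding. -/ theorem secWt'_one : secWt' cE cΛ 1 = cΛ := rfl
/-- [our object] Unfolding. -/ theorem secWt'_two : secWt' cE cΛ 2 = 1 := rfl
/-- [our object] Unfolding. -/ theorem SbT_apply (κ : Fin 4) (u : Site 4) : SbT κ u = SbE κ u - divK κ u := rfl
/-- [our object] Unfolding. -/
theorem SbRc_apply (κ : Fin 4) (u : Site 4) : SbRc n a cE cR cK cQ κ u = cR • SbR n a cK cQ κ u + cE • divK κ u := rfl

/-- [folklore] **THE TOTAL STENCIL IS UNCHANGED BY THE RE-CUT**: `SbfBal n a cE cVH cΛ cR cK cQ κ u = Σ_i secWt' i • secSt' i κ u`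
(`cE•(SbE − divK) + cΛ•SbL + (cR•SbR + cE•divK) = cE•SbE + cΛ•SbL + cR•SbR`, `GluonKernelSectors.SbfBal_eq_secSum`). -/
theorem SbfBal_eq_secSum' (κ : Fin 4) (u : Site 4) :
    SbfBal n a cE cVH cΛ cR cK cQ κ u = ∑ i : Fin 3, secWt' cE cΛ i • secSt' n a cE cR cK cQ i κ u := by
  rw [SbfBal_eq_secSum, Fin.sum_univ_three, Fin.sum_univ_three]
  simp only [GluonKernelSectors.secWt_zero, GluonKernelSectors.secWt_one, GluonKernelSectors.secWt_two, GluonKernelSectors.secSt_zero,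
    GluonKernelSectors.secSt_one, GluonKernelSectors.secSt_two, secWt'_zero, secWt'_one, secWt'_two, secSt'_zero, secSt'_one, secSt'_two,
    SbT_apply, SbRc_apply, smul_sub, smul_add, one_smul]
  abel

/-- [folklore] `divK` is bi-localised at its bond at rate `1` with ONE constant for all bonds (a finitely supported stencil). -/
theorem exists_biLoc_divK : ∃ C : ℝ, ∀ (κ : Fin 4) (u : Site 4), BiLoc (divK κ u) u u C 1 :=
  ⟨∑ κ : Fin 4, stnConst 1 (reixStn ιU (div₀ κ)), fun κ u =>
    biLoc_const_mono (biLoc_realK u u 1 _)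
      (single_le_sum (f := fun κ' : Fin 4 => stnConst 1 (reixStn ιU (div₀ κ'))) (fun _ _ => stnConst_nonneg _ _) (mem_univ κ))⟩

/-- [folklore] `SbT` is bi-localised at its bond, one constant, one positive rate, binder-free. -/
theorem exists_biLoc_SbT : ∃ Cs δ : ℝ, 0 < δ ∧ ∀ (κ : Fin 4) (u : Site 4), BiLoc (SbT κ u) u u Cs δ := by
  obtain ⟨C₁, δ₁, hδ₁, h₁⟩ := exists_biLoc_SbE
  obtain ⟨C₂, h₂⟩ := exists_biLoc_divK
  refine ⟨|C₁| + |C₂|, min δ₁ 1, lt_min hδ₁ one_pos, fun κ u => ?_⟩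
  rw [SbT_apply]
  exact KernelWard.biLoc_sub (biLoc_of_le (h₁ κ u) (min_le_left _ _)) (biLoc_of_le (h₂ κ u) (min_le_right _ _))

/-- [folklore] `SbRc` is bi-localised at its bond, one constant, one positive rate (`0 < a`, for the R-jet). -/
theorem exists_biLoc_SbRc (ha : 0 < a) : ∃ Cs δ : ℝ, 0 < δ ∧ ∀ (κ : Fin 4) (u : Site 4), BiLoc (SbRc n a cE cR cK cQ κ u) u u Cs δ := by
  obtain ⟨C₁, δ₁, hδ₁, h₁⟩ := exists_biLoc_SbR n a cK cQ ha
  obtain ⟨C₂, h₂⟩ := exists_biLoc_divK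
  refine ⟨|cR| * |C₁| + |cE| * |C₂|, min δ₁ 1, lt_min hδ₁ one_pos, fun κ u => ?_⟩
  rw [SbRc_apply]
  exact KernelWard.biLoc_add (StepJetData.biLoc_smul (biLoc_of_le (h₁ κ u) (min_le_left _ _)) cR)
    (StepJetData.biLoc_smul (biLoc_of_le (h₂ κ u) (min_le_right _ _)) cE)

/-- [folklore] **EVERY RE-CUT SECTOR IS BI-LOCALISED AT ITS BOND** (one constant, one positive rate per sector; `0 < a`). -/
theorem exists_biLoc_secSt' (ha : 0 < a) (i : Fin 3) :
    ∃ Cs δ : ℝ, 0 < δ ∧ ∀ (κ : Fin 4) (u : Site 4), BiLoc (secSt' n a cE cR cK cQ i κ u) u u Cs δ := by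
  fin_cases i
  · exact exists_biLoc_SbT
  · exact exists_biLoc_SbL n
  · exact exists_biLoc_SbRc n a cE cR cK cQ ha

/-- [folklore] Every re-cut sector stencil is localised in the `TameKernelCalculus` sense. -/
theorem loc_secSt' (ha : 0 < a) (i : Fin 3) (κ : Fin 4) (u : Site 4) : Loc (secSt' n a cE cR cK cQ i κ u) := by
  obtain ⟨Cs, δ, hδ, h⟩ := exists_biLoc_secSt' n a cE cR cK cQ ha i
  exact ⟨u, u, Cs, δ, hδ, h κ u⟩

end Sectors

/-! ## §3 The re-summation of the sector words and of the graded words of the fine bubble table -/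

section Resum

variable (n : ℕ) [NeZero n] (a : ℝ) (cE cVH cΛ cR cK cQ : ℝ)

/-- [folklore] **THE FINE BUBBLE TABLE OF THE GLUON PIECE AS THE NINE RE-CUT SECTOR WORDS** (`Spr (Ga n a)`, `0 < a`):
`bubbleTable n a (SbfBal …) κ′ λ′ u u′ = Σ_{i j} secWt' i · secWt' j · biBubbleTable Ga Ga (secSt' i) (secSt' j) κ′ λ′ u u′` — leaf-03-g3's
`bubbleTable_SbfBal_eq_secSum` over the re-cut family. -/
theorem bubbleTable_SbfBal_eq_secSum' (ha : 0 < a) (hGa : Spr (Ga n a)) (κ' l' : Fin 4) (u u' : Site 4) :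
    bubbleTable n a (SbfBal n a cE cVH cΛ cR cK cQ) κ' l' u u' =
      ∑ i : Fin 3, ∑ j : Fin 3, secWt' cE cΛ i * secWt' cE cΛ j *
        biBubbleTable (Ga n a) (Ga n a) (secSt' n a cE cR cK cQ i) (secSt' n a cE cR cK cQ j) κ' l' u u' := by
  rw [bubbleTable_apply, SbfBal_eq_secSum', SbfBal_eq_secSum',
    bubble_weightedSum_weightedSum univ univ hGa _ _ (fun i => loc_secSt' n a cE cR cK cQ ha i κ' u)
      (fun j => loc_secSt' n a cE cR cK cQ ha j l' u'),
    Finset.mul_sum]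
  refine Finset.sum_congr rfl fun i _ => ?_
  rw [Finset.mul_sum]
  refine Finset.sum_congr rfl fun j _ => ?_
  rw [biBubbleTable_apply, ← bubble_eq_biBubble]
  ring

/-- [folklore] **THE NINE RAW SECTOR WORDS AND THE NINE RE-CUT SECTOR WORDS HAVE THE SAME SUM** (both are the fine bubble table). -/
theorem secSum_eq_secSum' (ha : 0 < a) (hGa : Spr (Ga n a)) (κ' l' : Fin 4) (u u' : Site 4) :
    ∑ i : Fin 3, ∑ j : Fin 3, secWt cE cΛ cR i * secWt cE cΛ cR j *
        biBubbleTable (Ga n a) (Ga n a) (secSt n a cK cQ i) (secSt n a cK cQ j) κ' l' u u' =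
      ∑ i : Fin 3, ∑ j : Fin 3, secWt' cE cΛ i * secWt' cE cΛ j *
        biBubbleTable (Ga n a) (Ga n a) (secSt' n a cE cR cK cQ i) (secSt' n a cE cR cK cQ j) κ' l' u u' := by
  rw [← bubbleTable_SbfBal_eq_secSum n a cE 0 cΛ cR cK cQ ha hGa, bubbleTable_SbfBal_eq_secSum' n a cE 0 cΛ cR cK cQ ha hGa]

variable {g : Site 4 → ℝ}

/-- [folklore] **THE 81 RAW GRADED WORDS AND THE 81 RE-CUT GRADED WORDS HAVE THE SAME SUM** (legs split into the three pieces `legPiece n a g r`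
over ANY exponentially bounded profile `g`; `Spr (Ga n a)`, `0 < a`): both equal the fine bubble table. -/
theorem gradedSum_eq_gradedSum' (ha : 0 < a) (hGa : Spr (Ga n a)) {C δ : ℝ} (hδ : 0 < δ) (hg : ∀ v, |g v| ≤ C * Real.exp (-δ * l1 v))
    (κ' l' : Fin 4) (u u' : Site 4) :
    ∑ i : Fin 3, ∑ j : Fin 3, ∑ r : Fin 3, ∑ r' : Fin 3, secWt cE cΛ cR i * secWt cE cΛ cR j *
        biBubbleTable (legPiece n a g r) (legPiece n a g r') (secSt n a cK cQ i) (secSt n a cK cQ j) κ' l' u u' =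
      ∑ i : Fin 3, ∑ j : Fin 3, ∑ r : Fin 3, ∑ r' : Fin 3, secWt' cE cΛ i * secWt' cE cΛ j *
        biBubbleTable (legPiece n a g r) (legPiece n a g r') (secSt' n a cE cR cK cQ i) (secSt' n a cE cR cK cQ j) κ' l' u u' := by
  have hold : ∀ i j : Fin 3, ∑ r : Fin 3, ∑ r' : Fin 3, secWt cE cΛ cR i * secWt cE cΛ cR j *
      biBubbleTable (legPiece n a g r) (legPiece n a g r') (secSt n a cK cQ i) (secSt n a cK cQ j) κ' l' u u' =
      secWt cE cΛ cR i * secWt cE cΛ cR j * biBubbleTable (Ga n a) (Ga n a) (secSt n a cK cQ i) (secSt n a cK cQ j) κ' l' u u' := by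
    intro i j
    rw [biBubbleTable_Ga_eq_pieceSum n a hGa hδ hg (loc_secSt n a cK cQ ha i) (loc_secSt n a cK cQ ha j), Finset.mul_sum]
    exact Finset.sum_congr rfl fun r _ => by rw [Finset.mul_sum]
  have hnew : ∀ i j : Fin 3, ∑ r : Fin 3, ∑ r' : Fin 3, secWt' cE cΛ i * secWt' cE cΛ j *
      biBubbleTable (legPiece n a g r) (legPiece n a g r') (secSt' n a cE cR cK cQ i) (secSt' n a cE cR cK cQ j) κ' l' u u' =
      secWt' cE cΛ i * secWt' cE cΛ j * biBubbleTable (Ga n a) (Ga n a) (secSt' n a cE cR cK cQ i) (secSt' n a cE cR cK cQ j) κ' l' u u' := by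
    intro i j
    rw [biBubbleTable_Ga_eq_pieceSum n a hGa hδ hg (loc_secSt' n a cE cR cK cQ ha i) (loc_secSt' n a cE cR cK cQ ha j), Finset.mul_sum]
    exact Finset.sum_congr rfl fun r _ => by rw [Finset.mul_sum]
  simp only [hold, hnew]
  exact secSum_eq_secSum' n a cE cΛ cR cK cQ ha hGa κ' l' u u'

/-- [folklore] **THE SAME FOR THE WORD INTEGRANDS OF `SplitInstance.restK`** — ONE sum over `Fin 3 × Fin 3 × Fin 3 × Fin 3` of
`secWt i · secWt j · n⁻⁸·w_μw_ν·baseKer (biBubbleTable (legPiece r) (legPiece r′) (secSt i) (secSt j) μ ν) b w` equals the re-cut sum. -/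
theorem gradedWordSum_eq_gradedWordSum' (ha : 0 < a) (hGa : Spr (Ga n a)) {C δ : ℝ} (hδ : 0 < δ) (hg : ∀ v, |g v| ≤ C * Real.exp (-δ * l1 v))
    (μ ν : Fin 4) (b w : Pt) :
    ∑ x : Fin 3 × Fin 3 × Fin 3 × Fin 3, secWt cE cΛ cR x.1 * secWt cE cΛ cR x.2.1 *
        (((n : ℝ) ^ 8)⁻¹ * (toReal w μ * toReal w ν *
          baseKer (biBubbleTable (legPiece n a g x.2.2.1) (legPiece n a g x.2.2.2) (secSt n a cK cQ x.1) (secSt n a cK cQ x.2.1) μ ν) b w)) =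
      ∑ x : Fin 3 × Fin 3 × Fin 3 × Fin 3, secWt' cE cΛ x.1 * secWt' cE cΛ x.2.1 *
        (((n : ℝ) ^ 8)⁻¹ * (toReal w μ * toReal w ν *
          baseKer (biBubbleTable (legPiece n a g x.2.2.1) (legPiece n a g x.2.2.2) (secSt' n a cE cR cK cQ x.1) (secSt' n a cE cR cK cQ x.2.1)
            μ ν) b w)) := by
  have h := gradedSum_eq_gradedSum' n a cE cΛ cR cK cQ ha hGa hδ hg μ ν (b + w) b
  have e : ∀ (c : Fin 3 → ℝ) (T : Fin 3 → Fin 3 → Fin 3 → Fin 3 → ℝ),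
      ∑ x : Fin 3 × Fin 3 × Fin 3 × Fin 3, c x.1 * c x.2.1 * (((n : ℝ) ^ 8)⁻¹ * (toReal w μ * toReal w ν * T x.1 x.2.1 x.2.2.1 x.2.2.2)) =
      ((n : ℝ) ^ 8)⁻¹ * (toReal w μ * toReal w ν) * ∑ i : Fin 3, ∑ j : Fin 3, ∑ r : Fin 3, ∑ r' : Fin 3, c i * c j * T i j r r' := by
    intro c T
    rw [← SplitInstance.sum4_prod (fun i j r r' => c i * c j * (((n : ℝ) ^ 8)⁻¹ * (toReal w μ * toReal w ν * T i j r r'))), Finset.mul_sum]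
    refine Finset.sum_congr rfl fun i _ => ?_
    rw [Finset.mul_sum]
    refine Finset.sum_congr rfl fun j _ => ?_
    rw [Finset.mul_sum]
    refine Finset.sum_congr rfl fun r _ => ?_
    rw [Finset.mul_sum]
    exact Finset.sum_congr rfl fun r' _ => by ring
  simp only [baseKer] at h ⊢
  rw [e (secWt cE cΛ cR) (fun i j r r' => biBubbleTable (legPiece n a g r) (legPiece n a g r') (secSt n a cK cQ i) (secSt n a cK cQ j) μ ν (b + w) b),
    e (secWt' cE cΛ) (fun i j r r' => biBubbleTable (legPiece n a g r) (legPiece n a g r') (secSt' n a cE cR cK cQ i) (secSt' n a cE cR cK cQ j)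
      μ ν (b + w) b), h]

end Resum

end Summit.QuantumFields.BalabanUV.Beta.D1BFx.SectorRecut

end
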